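import Literature.Probability.Percolation.IntArmPieces
import Literature.Probability.Percolation.ArmSeparationIntFenceBound
import HarnessLib

/-!
# The setting of the same-colour pair step at an internal extremity (twin of `TrapPairSetting.lean`)

Topic `Literature/Probability/Percolation`; family `crit-perc` / near-critical percolation on `𝕋`.
A brick of the INNER half of the near-critical arm-separation theorem for four arms in the ADJACENT
colour arrangement (P. Nolin, EJP 13 (2008), Thm. 11, `j = 4`, `σ = BBWW` [arXiv 0711.4948:
Thm. 10], §4.4 Lemma 15, internal extremities, last paragraph of the proof: two arms of the same
colour). Two disjoint open self-avoiding arms of the annulus `{m ≤ |v| ≤ N}` from far ends of norm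
`N` (`N ≥ 4m`) to the inner side `x₀ = m` of `∂Λ_m`, clean at `∂Λ_m`, on the raw good event of
the exploration of the inner half-annulus `intDom m` in `ω`, every term of which has a MIDDLE tip
(`IntMidTip m R₀`, as the corner guards of the inner scheme guarantee, `intMidTip_of_guards`):

* `IntPairData m N k₀ K T R₀ ω` — the data; `armSet`, the stopping sets `S c = c ∪ (arms)`;
* the terms (`term_isCrossing`, `term_open`, `term_norm`, `tip_isIntJ'`, `tip_mid`, order facts);
* `jOf`/`kOf`/`raw` (a raw-good scale of each term), `fence hu : IntTermFence …` (the inner fence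
  stopped at `S c`), `Aset`, `Tset`;
* the planar position: `fence_disjoint_arm`, `fence_disjoint_term`, `row_gap_of_lt`,
  `fence_disjoint_fence`, `term_eq_of_mem_struct`, `norm_m'`, `m'_ne_of_ne`.

Everything here is proved; no named facts are introduced.

## References

* P. Nolin, Near-critical percolation in two dimensions, *Electron. J. Probab.* 13 (2008), §4.4
  Lemma 15 (proof), internal extremities (arXiv 0711.4948: Lemma 14; Thm. 10 p. 13) [Nolin2008].
* H. Kesten, *Percolation theory for mathematicians* (1982), §2.3 Prop. 2.3 [KestenPTM1982].
-/

noncomputable section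

open Set

namespace Literature.Probability.Percolation

open LatticeModels HalfAnnulus

/-! ### The data -/

/-- **The setting of the inner pair step** (side `0`, open colour): two disjoint open self-avoiding
arms of `{m ≤ |v| ≤ N}` from far ends beyond `Λ_{2m}` to the inner tip arc (`IsIntJ m`), clean at `∂Λ_m`, on
the raw good event of the exploration of `intDom m` in `ω` (all terms `u < T` raw-good on some scale
`k₀ · 32^j`, `j < K`), every term having a middle tip at margin `R₀ ≥ 32 k_j + 1`; `m ≥ 5`,
`4m ≤ N` (`N` is only an upper bound for the norms of the arm sites), `2 ≤ k₀`, `4 · 16 k_j < m`, `4 R₀ < m`. [cite: Nolin2008, §4.4 Lemma 15 (proof), internal extremities (arXiv 0711.4948: Lemma 14)] -/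
structure IntPairData (m N k₀ K T R₀ : ℕ) (ω : SiteConfig (Site 2)) where
  /-- the far ends -/
  b : Fin 2 → Site 2
  /-- the ends, on the inner tip arc -/
  y : Fin 2 → Site 2
  /-- the arms -/
  A : (i : Fin 2) → triGraph.Walk (b i) (y i)
  isPath : ∀ i, (A i).IsPath
  supp : ∀ i, ∀ v ∈ (A i).support, ((m : ℤ) ≤ triNorm v ∧ triNorm v ≤ N) ∧ v ∈ ω
  b_far : ∀ i, 2 * (m : ℤ) < triNorm (b i)
  y_isIntJ : ∀ i, IsIntJ m (y i)
  clean : ∀ i, ∀ v ∈ (A i).support, triNorm v = m → v = y i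
  disj : ∀ v ∈ (A 0).support, v ∉ (A 1).support
  stop : (intDom m).lowestSeq ω T = none
  good : ∀ u < T, ¬ IntSeqFailRaw m u k₀ K ω
  mid : ∀ u c z, (intDom m).lowestSeq ω u = some (c, z) → IntMidTip m R₀ z
  hm : 5 ≤ m
  hN : 4 * m ≤ N
  hk₀ : 2 ≤ k₀
  hKm : ∀ j < K, 4 * (16 * trapScale k₀ j) < m
  hKR : ∀ j < K, 32 * trapScale k₀ j + 1 ≤ R₀
  hR₀ : 4 * R₀ < m

namespace IntPairData

variable {m N k₀ K T R₀ : ℕ} {ω : SiteConfig (Site 2)}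

/-! ### The arms -/

/-- The sites of the two arms. [folklore] -/
def armSet (D : IntPairData m N k₀ K T R₀ ω) : Set (Site 2) := {v | ∃ i, v ∈ (D.A i).support}

/-- The stopping set of the fence of a term: the term and the arms. [folklore] -/
def S (D : IntPairData m N k₀ K T R₀ ω) (c : Finset (Site 2)) : Set (Site 2) := (↑c : Set (Site 2)) ∪ D.armSet

/-- Bookkeeping. [folklore] -/
theorem mem_armSet (D : IntPairData m N k₀ K T R₀ ω) {v : Site 2} {i : Fin 2} (hv : v ∈ (D.A i).support) : v ∈ D.armSet := ⟨i, hv⟩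

/-- Bookkeeping. [folklore] -/
theorem norm_ge (D : IntPairData m N k₀ K T R₀ ω) {i : Fin 2} {v : Site 2} (hv : v ∈ (D.A i).support) : (m : ℤ) ≤ triNorm v :=
  (D.supp i v hv).1.1

/-- Bookkeeping. [folklore] -/
theorem norm_le (D : IntPairData m N k₀ K T R₀ ω) {i : Fin 2} {v : Site 2} (hv : v ∈ (D.A i).support) : triNorm v ≤ N :=
  (D.supp i v hv).1.2

/-- Bookkeeping. [folklore] -/
theorem mem_omega (D : IntPairData m N k₀ K T R₀ ω) {i : Fin 2} {v : Site 2} (hv : v ∈ (D.A i).support) : v ∈ ω := (D.supp i v hv).2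

/-- Bookkeeping. [folklore] -/
theorem armSet_norm_ge (D : IntPairData m N k₀ K T R₀ ω) {v : Site 2} (hv : v ∈ D.armSet) : (m : ℤ) ≤ triNorm v := by
  obtain ⟨i, hv⟩ := hv; exact D.norm_ge hv

/-- Bookkeeping. [folklore] -/
theorem armSet_subset (D : IntPairData m N k₀ K T R₀ ω) : D.armSet ⊆ ω := fun _ ⟨_, hv⟩ => D.mem_omega hv

/-- The end is a site of the inner side, of norm `m`. [folklore] -/
theorem norm_y (D : IntPairData m N k₀ K T R₀ ω) (i : Fin 2) : triNorm (D.y i) = m := by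
  obtain ⟨h0, h1, h2⟩ := D.y_isIntJ i
  rw [triNorm_eq_max]; omega

/-- The end is a site of the half-annulus. [folklore] -/
theorem y_mem_haFin (D : IntPairData m N k₀ K T R₀ ω) (i : Fin 2) : D.y i ∈ haFin m := by
  obtain ⟨h0, h1, h2⟩ := D.y_isIntJ i
  have := D.norm_y i
  exact mem_haFin.2 ⟨by omega, by omega, by omega⟩

/-- The end is a site of the tip arc of `intDom m`. [folklore] -/
theorem y_mem_J (D : IntPairData m N k₀ K T R₀ ω) (i : Fin 2) : D.y i ∈ (intDom m).J :=
  mem_intDom_J.2 ⟨D.y_mem_haFin i, D.y_isIntJ i⟩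

/-- The two arms are disjoint, symmetric form. [folklore] -/
theorem disj' (D : IntPairData m N k₀ K T R₀ ω) {i j : Fin 2} (hij : i ≠ j) {v : Site 2} (hv : v ∈ (D.A i).support) : v ∉ (D.A j).support := by
  fin_cases i <;> fin_cases j
  · exact absurd rfl hij
  · exact D.disj v hv
  · exact fun h => D.disj v h hv
  · exact absurd rfl hij

/-! ### The terms -/

/-- Bookkeeping (`hcut`). [folklore] -/
theorem hcut (D : IntPairData m N k₀ K T R₀ ω) : (intDom m).CutProp := intDom_cutProp D.hm

/-- Bookkeeping (`hdual`). [folklore] -/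
theorem hdual (D : IntPairData m N k₀ K T R₀ ω) : (intDom m).DualProp := intDom_dualProp D.hm

/-- A term exists only below the stopping index. [folklore] -/
theorem lt_of_some (D : IntPairData m N k₀ K T R₀ ω) {u : ℕ} {c : Finset (Site 2)} {z : Site 2} (hu : (intDom m).lowestSeq ω u = some (c, z)) :
    u < T := by
  by_contra h
  rw [JDomain.lowestSeq_eq_none_of_le D.stop (not_lt.1 h)] at hu
  exact absurd hu (by simp)

/-- Bookkeeping (`term_isCrossing`). [folklore] -/
theorem term_isCrossing {u : ℕ} {c : Finset (Site 2)} {z : Site 2} (hu : (intDom m).lowestSeq ω u = some (c, z)) :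
    (intDom m).IsCrossing c z := (JDomain.isCrossing_of_lowestSeq hu).1

/-- Bookkeeping (`term_open`). [folklore] -/
theorem term_open {u : ℕ} {c : Finset (Site 2)} {z : Site 2} (hu : (intDom m).lowestSeq ω u = some (c, z)) :
    (↑c : Set (Site 2)) ⊆ ω := (JDomain.isCrossing_of_lowestSeq hu).2

/-- Bookkeeping (`term_norm`): sites of a term are half-annulus sites. [folklore] -/
theorem term_norm {u : ℕ} {c : Finset (Site 2)} {z : Site 2} (hu : (intDom m).lowestSeq ω u = some (c, z)) {v : Site 2} (hv : v ∈ c) :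
    (m : ℤ) ≤ triNorm v ∧ triNorm v ≤ 2 * m :=
  ⟨(mem_haFin.1 ((term_isCrossing hu).subset hv)).2.1, (mem_haFin.1 ((term_isCrossing hu).subset hv)).2.2⟩

/-- Bookkeeping (`tip_isIntJ`). [folklore] -/
theorem tip_isIntJ' {u : ℕ} {c : Finset (Site 2)} {z : Site 2} (hu : (intDom m).lowestSeq ω u = some (c, z)) : IsIntJ m z :=
  Literature.Probability.Percolation.tip_isIntJ (term_isCrossing hu)

/-- The tip of a term is a middle tip at every scale of the sequence. [folklore] -/
theorem tip_mid (D : IntPairData m N k₀ K T R₀ ω) {u : ℕ} {c : Finset (Site 2)} {z : Site 2} (hu : (intDom m).lowestSeq ω u = some (c, z))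
    {j : ℕ} (hj : j < K) : -(m : ℤ) + 32 * trapScale k₀ j + 1 ≤ z 1 ∧ z 1 ≤ -(32 * (trapScale k₀ j : ℤ) + 1) := by
  have h1 := D.mid u c z hu
  have h2 := D.hKR j hj
  unfold IntMidTip at h1
  have h3 : (32 * trapScale k₀ j + 1 : ℕ) ≤ (R₀ : ℤ) := by exact_mod_cast h2
  push_cast at h3
  omega

/-- A later term lies above an earlier one. [cite: KestenPTM1982, §2.3 Prop. 2.3] -/
theorem term_above_of_lt (D : IntPairData m N k₀ K T R₀ ω) {u v : ℕ} (huv : u < v) {c c' : Finset (Site 2)} {z z' : Site 2}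
    (hu : (intDom m).lowestSeq ω u = some (c, z)) (hv : (intDom m).lowestSeq ω v = some (c', z')) :
    c' ⊆ (intDom m).above c z := JDomain.lowestSeq_subset_above_of_lt D.hcut huv hu hv

/-- A later term lies off `lower` of an earlier one. [cite: KestenPTM1982, §2.3 Prop. 2.3] -/
theorem term_offLower_of_lt (D : IntPairData m N k₀ K T R₀ ω) {u v : ℕ} (huv : u < v) {c c' : Finset (Site 2)} {z z' : Site 2}
    (hu : (intDom m).lowestSeq ω u = some (c, z)) (hv : (intDom m).lowestSeq ω v = some (c', z')) :
    ∀ x ∈ c', x ∉ (intDom m).lower c z := fun _ hx hxl =>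
  (JDomain.mem_lower_iff_not_mem_above ((term_isCrossing hv).subset hx)).1 hxl (D.term_above_of_lt huv hu hv hx)

/-- Distinct terms are disjoint. [cite: KestenPTM1982, §2.3 Prop. 2.3] -/
theorem term_disjoint_of_lt (D : IntPairData m N k₀ K T R₀ ω) {u v : ℕ} (huv : u < v) {c c' : Finset (Site 2)} {z z' : Site 2}
    (hu : (intDom m).lowestSeq ω u = some (c, z)) (hv : (intDom m).lowestSeq ω v = some (c', z')) :
    Disjoint c c' := JDomain.lowestSeq_disjoint_of_lt D.hcut huv hu hv

/-- An earlier term lies below a later one. [cite: KestenPTM1982, §2.3 Prop. 2.3] -/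
theorem term_below_of_lt (D : IntPairData m N k₀ K T R₀ ω) {u v : ℕ} (huv : u < v) {c c' : Finset (Site 2)} {z z' : Site 2}
    (hu : (intDom m).lowestSeq ω u = some (c, z)) (hv : (intDom m).lowestSeq ω v = some (c', z')) :
    c ⊆ (intDom m).below c' z' := by
  intro x hx
  have hl : x ∈ (intDom m).lower c' z' :=
    JDomain.lower_subset_lower_of_le D.hcut huv.le hu hv (JDomain.mem_lower.2 (Or.inl hx))
  rcases JDomain.mem_lower.1 hl with h | h
  · exact absurd h (Finset.disjoint_left.1 (D.term_disjoint_of_lt huv hu hv) hx)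
  · exact h

/-- The tips increase. [cite: KestenPTM1982, §2.3 Prop. 2.3] -/
theorem tip_lt_of_lt (D : IntPairData m N k₀ K T R₀ ω) {u v : ℕ} (huv : u < v) {c c' : Finset (Site 2)} {z z' : Site 2}
    (hu : (intDom m).lowestSeq ω u = some (c, z)) (hv : (intDom m).lowestSeq ω v = some (c', z')) : z 1 < z' 1 := by
  have := JDomain.ht_lowestSeq_lt_of_lt D.hcut huv hu hv
  simpa using this

/-- Terms with the same index coincide. [folklore] -/
theorem term_eq {u : ℕ} {c c' : Finset (Site 2)} {z z' : Site 2}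
    (hu : (intDom m).lowestSeq ω u = some (c, z)) (hu' : (intDom m).lowestSeq ω u = some (c', z')) : c = c' ∧ z = z' := by
  rw [hu] at hu'
  simp only [Option.some.injEq, Prod.mk.injEq] at hu'
  exact hu'

/-! ### The scale and the fence of a term -/

/-- The index of a raw-good scale of the term. [folklore] -/
def jOf (D : IntPairData m N k₀ K T R₀ ω) {u : ℕ} {c : Finset (Site 2)} {z : Site 2} (hu : (intDom m).lowestSeq ω u = some (c, z)) : ℕ :=
  Classical.choose (exists_intRawOK_of_not_failRaw (D.good u (D.lt_of_some hu)) hu)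

/-- Bookkeeping (`jOf_spec`). [folklore] -/
theorem jOf_spec (D : IntPairData m N k₀ K T R₀ ω) {u : ℕ} {c : Finset (Site 2)} {z : Site 2} (hu : (intDom m).lowestSeq ω u = some (c, z)) :
    D.jOf hu < K ∧ IntRawOK m c z (trapScale k₀ (D.jOf hu)) ω :=
  Classical.choose_spec (exists_intRawOK_of_not_failRaw (D.good u (D.lt_of_some hu)) hu)

/-- The raw-good scale of the term. [folklore] -/
def kOf (D : IntPairData m N k₀ K T R₀ ω) {u : ℕ} {c : Finset (Site 2)} {z : Site 2} (hu : (intDom m).lowestSeq ω u = some (c, z)) : ℕ :=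
  trapScale k₀ (D.jOf hu)

/-- Bookkeeping (`raw`). [folklore] -/
theorem raw (D : IntPairData m N k₀ K T R₀ ω) {u : ℕ} {c : Finset (Site 2)} {z : Site 2} (hu : (intDom m).lowestSeq ω u = some (c, z)) :
    IntRawOK m c z (D.kOf hu) ω := (D.jOf_spec hu).2

/-- Bookkeeping (`one_le_kOf`). [folklore] -/
theorem one_le_kOf (D : IntPairData m N k₀ K T R₀ ω) {u : ℕ} {c : Finset (Site 2)} {z : Site 2} (hu : (intDom m).lowestSeq ω u = some (c, z)) :
    1 ≤ D.kOf hu := one_le_trapScale (by have := D.hk₀; omega) _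

/-- Bookkeeping (`two_le_kOf`). [folklore] -/
theorem two_le_kOf (D : IntPairData m N k₀ K T R₀ ω) {u : ℕ} {c : Finset (Site 2)} {z : Site 2} (hu : (intDom m).lowestSeq ω u = some (c, z)) :
    2 ≤ D.kOf hu := Nat.mul_le_mul D.hk₀ (Nat.one_le_pow _ _ (by norm_num))

/-- Bookkeeping (`kOf_lt`): `4 · 16 k < m`. [folklore] -/
theorem kOf_lt (D : IntPairData m N k₀ K T R₀ ω) {u : ℕ} {c : Finset (Site 2)} {z : Site 2} (hu : (intDom m).lowestSeq ω u = some (c, z)) :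
    4 * (16 * D.kOf hu) < m := D.hKm _ (D.jOf_spec hu).1

/-- Bookkeeping (`tip_midOf`): the tip is middle at the raw-good scale. [folklore] -/
theorem tip_midOf (D : IntPairData m N k₀ K T R₀ ω) {u : ℕ} {c : Finset (Site 2)} {z : Site 2} (hu : (intDom m).lowestSeq ω u = some (c, z)) :
    -(m : ℤ) + 32 * D.kOf hu + 1 ≤ z 1 ∧ z 1 ≤ -(32 * (D.kOf hu : ℤ) + 1) := D.tip_mid hu (D.jOf_spec hu).1

/-- Bookkeeping (`c_subset_S`). [folklore] -/
theorem c_subset_S (D : IntPairData m N k₀ K T R₀ ω) (c : Finset (Site 2)) : (↑c : Set (Site 2)) ⊆ D.S c := Set.subset_union_left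

/-- Bookkeeping (`S_norm_ge`). [folklore] -/
theorem S_norm_ge (D : IntPairData m N k₀ K T R₀ ω) {u : ℕ} {c : Finset (Site 2)} {z : Site 2} (hu : (intDom m).lowestSeq ω u = some (c, z)) :
    ∀ v ∈ D.S c, (m : ℤ) ≤ triNorm v := by
  rintro v (hv | hv)
  · exact (term_norm hu (Finset.mem_coe.1 hv)).1
  · exact D.armSet_norm_ge hv

/-- **The inner fence of the term, stopped at `c ∪ (arms)`.** [cite: Nolin2008, §4.4 Lemma 15 (proof), internal extremities (arXiv 0711.4948: Lemma 14)] -/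
def fence (D : IntPairData m N k₀ K T R₀ ω) {u : ℕ} {c : Finset (Site 2)} {z : Site 2} (hu : (intDom m).lowestSeq ω u = some (c, z)) :
    IntTermFence m c z (D.kOf hu) ω (D.S c) :=
  Classical.choice ((D.raw hu).nonempty_intTermFence D.hm (D.one_le_kOf hu) (term_isCrossing hu)
    (by have := D.tip_midOf hu; omega) (D.c_subset_S c) (D.S_norm_ge hu))

/-! ### The admissible set and the targets -/

/-- **The admissible sites**: the arms, the terms, the connections of their fences. [cite: Nolin2008, §4.4 Lemma 15 (proof), internal extremities (arXiv 0711.4948: Lemma 14)] -/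
def Aset (D : IntPairData m N k₀ K T R₀ ω) : Set (Site 2) :=
  D.armSet ∪ {v | ∃ (u : ℕ) (c : Finset (Site 2)) (z : Site 2) (hu : (intDom m).lowestSeq ω u = some (c, z)),
    v ∈ (↑c : Set (Site 2)) ∨ v ∈ (D.fence hu).F}

/-- **The targets**: the fence sites of the terms, inside `Λ_m`. [cite: Nolin2008, §4.4 Lemma 15 (proof), internal extremities (arXiv 0711.4948: Lemma 14)] -/
def Tset (D : IntPairData m N k₀ K T R₀ ω) : Set (Site 2) :=
  {v | ∃ (u : ℕ) (c : Finset (Site 2)) (z : Site 2) (hu : (intDom m).lowestSeq ω u = some (c, z)), v = (D.fence hu).m'}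

/-- Bookkeeping. [folklore] -/
theorem armSet_subset_Aset (D : IntPairData m N k₀ K T R₀ ω) : D.armSet ⊆ D.Aset := Set.subset_union_left

/-- Bookkeeping. [folklore] -/
theorem term_subset_Aset (D : IntPairData m N k₀ K T R₀ ω) {u : ℕ} {c : Finset (Site 2)} {z : Site 2} (hu : (intDom m).lowestSeq ω u = some (c, z)) :
    (↑c : Set (Site 2)) ⊆ D.Aset := fun _ hv => Or.inr ⟨u, c, z, hu, Or.inl hv⟩

/-- Bookkeeping. [folklore] -/
theorem fence_subset_Aset (D : IntPairData m N k₀ K T R₀ ω) {u : ℕ} {c : Finset (Site 2)} {z : Site 2} (hu : (intDom m).lowestSeq ω u = some (c, z)) :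
    (D.fence hu).F ⊆ D.Aset := fun _ hv => Or.inr ⟨u, c, z, hu, Or.inr hv⟩

/-- Bookkeeping. [folklore] -/
theorem m'_mem_Tset (D : IntPairData m N k₀ K T R₀ ω) {u : ℕ} {c : Finset (Site 2)} {z : Site 2} (hu : (intDom m).lowestSeq ω u = some (c, z)) :
    (D.fence hu).m' ∈ D.Tset := ⟨u, c, z, hu, rfl⟩

/-- The admissible sites are open. [folklore] -/
theorem Aset_subset (D : IntPairData m N k₀ K T R₀ ω) : D.Aset ⊆ ω := by
  rintro v (hv | ⟨u, c, z, hu, hv | hv⟩)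
  · exact D.armSet_subset hv
  · exact term_open hu hv
  · exact intFenceSet_subset ((D.fence hu).F_subset hv)

/-! ### The planar position of the fences -/

/-- The connection of a fence avoids the arms. [folklore] -/
theorem fence_disjoint_arm (D : IntPairData m N k₀ K T R₀ ω) {u : ℕ} {c : Finset (Site 2)} {z : Site 2} (hu : (intDom m).lowestSeq ω u = some (c, z))
    {v : Site 2} (hv : v ∈ (D.fence hu).F) : v ∉ D.armSet := fun h =>
  intFenceSet_disjoint ((D.fence hu).F_subset hv) (Or.inr h)

/-- The connection of a fence avoids every term. [cite: Nolin2008, §4.4 Lemma 15 (proof), internal extremities (arXiv 0711.4948: Lemma 14)] -/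
theorem fence_disjoint_term (D : IntPairData m N k₀ K T R₀ ω) {u v : ℕ} {c c' : Finset (Site 2)} {z z' : Site 2}
    (hu : (intDom m).lowestSeq ω u = some (c, z)) (hv : (intDom m).lowestSeq ω v = some (c', z'))
    {x : Site 2} (hx : x ∈ (D.fence hu).F) : x ∉ c' := by
  rcases lt_trichotomy v u with h | rfl | h
  · exact (D.fence hu).not_mem_of_subset_below (D.term_below_of_lt h hv hu) hx
  · have := (term_eq hu hv).1; subst this
    exact fun h => intFenceSet_disjoint ((D.fence hu).F_subset hx) (Or.inl (Finset.mem_coe.2 h))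
  · exact (D.fence hu).not_mem_of_offLower (D.raw hu) (D.one_le_kOf hu) (by have := D.kOf_lt hu; omega)
      (term_isCrossing hu) (term_isCrossing hv) (term_open hv) (D.term_offLower_of_lt h hu hv) hx

/-- **Tips of distinct terms are far apart** in the scale of the lower one. [cite: Nolin2008, §4.4 Lemma 15 (proof), internal extremities (arXiv 0711.4948: Lemma 14)] -/
theorem row_gap_of_lt (D : IntPairData m N k₀ K T R₀ ω) {u v : ℕ} (huv : u < v) {c c' : Finset (Site 2)} {z z' : Site 2}
    (hu : (intDom m).lowestSeq ω u = some (c, z)) (hv : (intDom m).lowestSeq ω v = some (c', z')) :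
    z 1 + 17 * D.kOf hu < z' 1 :=
  (D.raw hu).row_gap (D.one_le_kOf hu) (D.kOf_lt hu) (term_isCrossing hu) (term_isCrossing hv) (term_open hv)
    (D.term_offLower_of_lt huv hu hv) (D.tip_lt_of_lt huv hu hv)

/-- **Connections of distinct fences are disjoint.** [cite: Nolin2008, §4.4 Lemma 15 (proof), internal extremities (arXiv 0711.4948: Lemma 14)] -/
theorem fence_disjoint_fence (D : IntPairData m N k₀ K T R₀ ω) {u v : ℕ} (huv : u ≠ v) {c c' : Finset (Site 2)} {z z' : Site 2}
    (hu : (intDom m).lowestSeq ω u = some (c, z)) (hv : (intDom m).lowestSeq ω v = some (c', z'))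
    {x : Site 2} (hx : x ∈ (D.fence hu).F) : x ∉ (D.fence hv).F := by
  intro hx'
  wlog h : u < v generalizing u v c c' z z'
  · exact this huv.symm hv hu hx' hx (lt_of_le_of_ne (not_lt.1 h) huv.symm)
  have hgap := D.row_gap_of_lt h hu hv
  have hk := D.one_le_kOf hu
  by_cases hn : (m : ℤ) ≤ triNorm x
  · have hxa := (mem_intFenceSet_inside ((D.fence hv).F_subset hx') hn).2.1
    exact (D.fence hu).not_mem_above_of_row_lt D.hm hk (tip_isIntJ' hu) (by have := D.tip_midOf hu; omega) (term_isCrossing hv)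
      (by omega) (fun w hw => D.fence_disjoint_term hu hv hw) hx hn hxa
  · rw [not_le] at hn
    have h1 := mem_intFenceSet_beyond ((D.fence hv).F_subset hx') hn
    have h2 := (intFenceSet_box ((D.fence hu).F_subset hx)).2.2.2
    omega

/-- **A site lies in the structure `c_u ∪ F_u` of at most one term.** [folklore] -/
theorem term_eq_of_mem_struct (D : IntPairData m N k₀ K T R₀ ω) {u v : ℕ} {c c' : Finset (Site 2)} {z z' : Site 2}
    (hu : (intDom m).lowestSeq ω u = some (c, z)) (hv : (intDom m).lowestSeq ω v = some (c', z'))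
    {x : Site 2} (hxu : x ∈ (↑c : Set (Site 2)) ∨ x ∈ (D.fence hu).F) (hxv : x ∈ (↑c' : Set (Site 2)) ∨ x ∈ (D.fence hv).F) : u = v := by
  by_contra hne
  rcases hxu with hxu | hxu <;> rcases hxv with hxv | hxv
  · rcases lt_or_gt_of_ne hne with h | h
    · exact Finset.disjoint_left.1 (D.term_disjoint_of_lt h hu hv) (Finset.mem_coe.1 hxu) (Finset.mem_coe.1 hxv)
    · exact Finset.disjoint_left.1 (D.term_disjoint_of_lt h hv hu) (Finset.mem_coe.1 hxv) (Finset.mem_coe.1 hxu)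
  · exact D.fence_disjoint_term hv hu hxv (Finset.mem_coe.1 hxu)
  · exact D.fence_disjoint_term hu hv hxu (Finset.mem_coe.1 hxv)
  · exact D.fence_disjoint_fence hne hu hv hxu hxv

/-- The fence site of a term is inside `Λ_m`. [folklore] -/
theorem norm_m' (D : IntPairData m N k₀ K T R₀ ω) {u : ℕ} {c : Finset (Site 2)} {z : Site 2} (hu : (intDom m).lowestSeq ω u = some (c, z)) :
    triNorm (D.fence hu).m' < m :=
  (D.fence hu).norm_m' (D.one_le_kOf hu) (tip_isIntJ' hu) (by have := D.tip_midOf hu; omega)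

/-- Distinct terms have distinct fence sites. [folklore] -/
theorem m'_ne_of_ne (D : IntPairData m N k₀ K T R₀ ω) {u v : ℕ} (huv : u ≠ v) {c c' : Finset (Site 2)} {z z' : Site 2}
    (hu : (intDom m).lowestSeq ω u = some (c, z)) (hv : (intDom m).lowestSeq ω v = some (c', z')) :
    (D.fence hu).m' ≠ (D.fence hv).m' := fun h =>
  D.fence_disjoint_fence huv hu hv (D.fence hu).m'_mem (h ▸ (D.fence hv).m'_mem)

end IntPairData

end Literature.Probability.Percolation
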